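import Literature.MathematicalPhysics.KineticTheory.FouriersLaw
import HarnessLib

/-!
# Fourier's law for oscillator chains: what can and cannot be asserted unconditionally

Trunk T-KINETIC (Literature/MathematicalPhysics/KineticTheory); companion to `FouriersLaw.lean`
(definition of `OscillatorChain.FouriersLawFor` after Bonetto–Lebowitz–Rey-Bellet 2000, §5.3
eq. (33)).

## Why there is no `FouriersLawFor_holds`

`OscillatorChain.FouriersLawFor : OscillatorChain → Prop` is a PREDICATE on chains (data
`U, V, γ`), not a closed published result: for a given chain `P` it asserts (i) existence and
uniqueness of the steady state for every length and all bath temperatures and (ii) BLR's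
eq. (33), `κ(T) = lim_{L→∞} L lim_{δT→0} μ(Φ)/δT` with `0 < κ(T) < ∞`. The source states (ii) as
the OPEN PROBLEM of its title — "The existence of such a limit with `κ` positive and finite is
what one would like to prove" (§1), "there is however at present no rigorous mathematical
derivation of Fourier's law … for any system (or model) with a deterministic, Hamiltonian,
microscopic evolution" (§1), "Nothing is known about the dependence of `D` on `L` and thus ipso
facto about the validity of Fourier's law" (§6.3) — and the tree records its instance for the
pinned anharmonic chain as the conjecture `FouriersLaw` (a `def … : Prop`, conjunct of the summit
`AtomisticToContinuum`; lean/CONVENTIONS.md §4: open conjectures are never asserted as theorems).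

This file proves, sorry-free, the elementary facts that make the situation kernel-visible:

* `OscillatorChain.bondCurrent_eq_zero_of_deriv_V`, `OscillatorChain.totalCurrent_eq_zero_of_deriv_V`
  — a chain without interaction force (`V' ≡ 0`, e.g. `V` constant) carries no energy current in
  any state (BLR eq. (23): `j_i = -½(p_i + p_{i+1}) V'(q_{i+1} - q_i)`).
* `OscillatorChain.not_fouriersLawFor_of_deriv_V` — hence `FouriersLawFor P` FAILS for every such
  chain: if steady states exist (conjunct (i)), the linear-response coefficients `D_N` of the zero
  current all vanish, so the conductivity of (ii) would be `κ(T) = 0`, contradicting `0 < κ(T)`.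
* `not_forall_fouriersLawFor` — in particular `¬ ∀ P, P.FouriersLawFor`: the predicate is
  non-trivial and admits no unconditional discharge; which chains satisfy it (pinned anharmonic:
  conjectured yes; harmonic: no, the flux is `L`-independent, Rieder–Lebowitz–Lieb 1967, BLR §6.2)
  is exactly the physics.

Nothing here bears on the conjecture `FouriersLaw` itself (the chains `pinnedChain ω₂ lam β γ`
with `β > 0` have `V'(r) = r + β r³ ≢ 0`).
-/

noncomputable section

open MeasureTheory Filter
open _root_.Topology

namespace Literature.MathematicalPhysics.KineticTheory.HeatConduction

namespace OscillatorChain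

variable (P : OscillatorChain)

/-- A chain whose interaction exerts no force (`V' ≡ 0`) has vanishing bond currents
`j_i = -½ (p_i + p_{i+1}) V'(q_{i+1} - q_i) = 0`. [Bonetto–Lebowitz–Rey-Bellet 2000, §5.2
eq. (23)] [folklore] -/
theorem bondCurrent_eq_zero_of_deriv_V (hV : ∀ r, deriv P.V r = 0) (N : ℕ) (i : Fin N)
    (x : PhaseSpace N) : P.bondCurrent N i x = 0 := by
  simp [bondCurrent, hV]

/-- Hence such a chain carries no space-summed current in any state `μ` whatsoever.
[folklore] -/
theorem totalCurrent_eq_zero_of_deriv_V (hV : ∀ r, deriv P.V r = 0) {N : ℕ}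
    (μ : Measure (PhaseSpace N)) : P.totalCurrent μ = 0 := by
  simp [totalCurrent, P.bondCurrent_eq_zero_of_deriv_V hV]

/-- **No Fourier law without interaction.** If `V' ≡ 0` then `FouriersLawFor P` is false:
granted conjunct (i) (steady states exist for all `N`, `T_L, T_R > 0`), pick any family of them;
its currents vanish identically (`totalCurrent_eq_zero_of_deriv_V`), so for every `N` the
linear-response limit `D_N = lim_{δ→0} 0/δ` is `0`, whence the conductivity `κ(T) = lim_N D_N`
demanded by conjunct (ii) is `0`, contradicting `0 < κ(T)`. This is the kernel-checked reason why
the predicate `FouriersLawFor` (Bonetto–Lebowitz–Rey-Bellet's eq. (33), an open problem for every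
deterministic anharmonic bulk) has no unconditional discharge `∀ P, P.FouriersLawFor`.
[Bonetto–Lebowitz–Rey-Bellet 2000, §1 ("the existence of such a limit with `κ` positive and
finite is what one would like to prove") and §5.3 eq. (33)] [folklore] -/
theorem not_fouriersLawFor_of_deriv_V (hV : ∀ r, deriv P.V r = 0) : ¬ P.FouriersLawFor := by
  rintro ⟨hex, κ, hκ, hlin⟩
  classical
  -- the family of steady states granted by conjunct (i) (junk `0` off the positive quadrant)
  let μ : (N : ℕ) → ℝ → ℝ → Measure (PhaseSpace N) := fun N T_L T_R =>
    if h : 0 < T_L ∧ 0 < T_R then (hex N T_L T_R h.1 h.2).choose else 0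
  have hfam : ∀ (N : ℕ) (T_L T_R : ℝ), 0 < T_L → 0 < T_R →
      P.IsSteadyState N T_L T_R (μ N T_L T_R) := by
    intro N T_L T_R h1 h2
    simp only [μ, dif_pos (And.intro h1 h2)]
    exact (hex N T_L T_R h1 h2).choose_spec.1
  obtain ⟨D, hD, hDκ⟩ := hlin μ hfam 1 one_pos
  haveI : (𝓝[≠] (0 : ℝ)).NeBot := NormedField.nhdsNE_neBot 0
  -- every linear-response coefficient vanishes
  have hD0 : ∀ N, D N = 0 := fun N => by
    have h : Tendsto (fun _ : ℝ => (0 : ℝ)) (𝓝[≠] (0 : ℝ)) (𝓝 (D N)) := by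
      simpa only [P.totalCurrent_eq_zero_of_deriv_V hV, zero_div] using hD N
    exact tendsto_nhds_unique h tendsto_const_nhds
  -- hence the conductivity at `T = 1` vanishes
  have hκ0 : κ 1 = 0 := by
    have hDfun : D = fun _ => 0 := funext hD0
    rw [hDfun] at hDκ
    exact tendsto_nhds_unique hDκ tendsto_const_nhds
  exact (hκ 1 one_pos).ne' hκ0

end OscillatorChain

/-- **`FouriersLawFor` has no unconditional discharge**: the interaction-free chain
`U = V = 0`, `γ = 0` violates it (`OscillatorChain.not_fouriersLawFor_of_deriv_V`), so
`¬ ∀ P, P.FouriersLawFor`. Which chains DO satisfy it is the open problem of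
Bonetto–Lebowitz–Rey-Bellet 2000 (its instance for the pinned anharmonic chain is the conjecture
`FouriersLaw`). [Bonetto–Lebowitz–Rey-Bellet 2000, §1 and §5.3 eq. (33)] [folklore] -/
theorem not_forall_fouriersLawFor : ¬ ∀ P : OscillatorChain, P.FouriersLawFor := fun h =>
  OscillatorChain.not_fouriersLawFor_of_deriv_V ⟨fun _ => 0, fun _ => 0, 0⟩
    (fun r => by simp) (h _)

end Literature.MathematicalPhysics.KineticTheory.HeatConduction
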